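import Mathlib
import Summits.Ventures.HodgeRepro.Tier4.Line1.RTFSetting
import Summits.Ventures.HodgeRepro.Tier4.Line4.L1Class
import Summits.Ventures.HodgeRepro.Tier4.Line4.L1ClassV4
import Summits.Ventures.HodgeRepro.Tier4.Line4.TailWrapper

/-!
# Tier4/Line4/TailWrapperFibre — TailWrapper re-pointed to the v4 FIBRE shape: `L1Class.LevelFibreDominated` with
`E = {o₀}` from the five displays, through `fibreDominated_singleton_of_tailDominated`

Blind re-derivation cell `pub-hodge-repro`, Tier 4 (README §9–§10), seat t4-L1-p4 (gen 4), plan-4's cut S15084 («then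
re-point TailWrapper through `fibreDominated_singleton_of_tailDominated`»).  Target tree path
`lean/Summits/Ventures/HodgeRepro/Tier4/Line4/TailWrapperFibre.lean`.  Imports L1ClassV4 (p702851) and this seat's
TailWrapper (p701727).  0 print.

WHAT IS PROVED.  `fibreDominatedFrom_singleton_of_support_count` (generic) and **`levelFibreDominated_singleton_of_support_count`**
(on `GA W`, for the level family `N ↦ prodFn finf (ffin N) ⋆ f₂ N`): `L1Class.LevelFibreDominated W S χ χ' {o₀} finf ffin f₂` from
(S1) sparsity (from a level `N₂` on), (S2′) the count on the support uniform in the level, (S3) decay, (S4) the main term,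
PLUS the orbit expansion of the geometric side as v4 consumes it — `RtfGeometricL1 S`, the characters, and `IsTestL1` /
`PoincareSummable` for each member of the family (the `hgeo` of the `TailDominated` wrappers, in v4's vocabulary).  So the
v4 display `TailForArch''` holds with `E = {orbitOf γ₀}` as soon as the displays are proved for the witness family — the
ORBSEP-free case.  Nothing here says anything about the status of the Hodge conjecture for CM abelian varieties, which is
NOT proved (HC_CM is NOT proved by anyone in this repository).
-/

set_option autoImplicit false

noncomputable section

namespace Summit.Ventures.HodgeRepro.Tier4.Line4

open Filter Topology Summit.Ventures.HodgeRepro.Tier4.Common Summit.Ventures.HodgeRepro.Tier4.Line1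
  Summit.Ventures.HodgeRepro.Tier4.Line1.RTF

section Abstract

variable {G : Type} [Group G] [TopologicalSpace G] [MeasurableSpace G] (S : Setting G)

/-- **the fibre shape with `E = {o₀}` from the displays**: (S1) sparsity from a level `N₂` on, (S2′) count on the
support, (S3) decay, (S4) main term, and the orbit expansion (`RtfGeometricL1`, the characters, `IsTestL1` +
`PoincareSummable` for every member of the family). -/
theorem fibreDominatedFrom_singleton_of_support_count (hgeo : L1Class.RtfGeometricL1 S) {χ : S.T → ℂ}
    {χ' : S.T' → ℂ} (hχ : S.IsCharacter χ) (hχ' : S.IsCharacter' χ') (o₀ : S.Orbit) (f : ℕ → G → ℂ)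
    (hf : ∀ N, IsTestL1 S (f N)) (hP : ∀ N, L1Class.PoincareSummable S (f N))
    (d : S.Orbit → ℝ) (g : ℕ → ℝ) (hd : ∀ o, 0 ≤ d o) {C C' α β δ : ℝ} (hC : 0 ≤ C) (hC' : 0 ≤ C')
    (hαβ : α < β) (hβ : 0 ≤ β) (hδ : 0 < δ) (hg : Tendsto g atTop atTop)
    (hcount : ∀ (N : ℕ) (T : ℝ), ∃ s : Finset S.Orbit,
      (∀ o, S.orbital χ χ' o (f N) ≠ 0 → d o ≤ T → o ∈ s) ∧ (s.card : ℝ) ≤ C' * Real.exp (α * T))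
    (hdecay : ∀ N o, o ≠ o₀ → ‖S.orbital χ χ' o (f N)‖ ≤ C * Real.exp (-((β + δ) * d o)))
    {N₂ : ℕ} (hsparse : ∀ N, N₂ < N → ∀ o, o ≠ o₀ → S.orbital χ χ' o (f N) ≠ 0 → g N ≤ d o)
    (hmain : ∃ m : ℝ, 0 < m ∧ ∃ N₁ : ℕ, ∀ N ≥ N₁, m ≤ ‖S.orbital χ χ' o₀ (f N)‖) :
    L1Class.FibreDominatedFrom S χ χ' {o₀} f := by
  obtain ⟨N₀, hN₀⟩ := tailDominatedFrom_of_support_count' S χ χ' o₀ f d g hd hC hC' hαβ hβ hδ hg hcount hdecay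
    hsparse hmain
  exact ⟨N₀, fun N hN =>
    L1Class.fibreDominated_singleton_of_tailDominated hgeo hχ hχ' (hf N) (hP N) (hN₀ N hN)⟩

end Abstract

section Arch

open NumberField

variable {k : Type} [Field k] [NumberField k] (W : PlaneData k) [MeasurableSpace (GA W)]

/-- **C-L4-TAIL in the v4 fibre shape, `E = {o₀}`**: `LevelFibreDominated` for the level family
`N ↦ prodFn finf (ffin N) ⋆ f₂ N` from the five displays and the orbit expansion. -/
theorem levelFibreDominated_singleton_of_support_count (S : Setting (GA W)) (hgeo : L1Class.RtfGeometricL1 S)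
    {χ : S.T → ℂ} {χ' : S.T' → ℂ} (hχ : S.IsCharacter χ) (hχ' : S.IsCharacter' χ') (o₀ : S.Orbit)
    (finf : GA W → ℂ) (ffin f₂ : ℕ → GA W → ℂ)
    (hf : ∀ N, IsTestL1 S (S.conv (L1Class.prodFn W finf (ffin N)) (f₂ N)))
    (hP : ∀ N, L1Class.PoincareSummable S (S.conv (L1Class.prodFn W finf (ffin N)) (f₂ N)))
    (d : S.Orbit → ℝ) (g : ℕ → ℝ) (hd : ∀ o, 0 ≤ d o) {C C' α β δ : ℝ} (hC : 0 ≤ C) (hC' : 0 ≤ C')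
    (hαβ : α < β) (hβ : 0 ≤ β) (hδ : 0 < δ) (hg : Tendsto g atTop atTop)
    (hcount : ∀ (N : ℕ) (T : ℝ), ∃ s : Finset S.Orbit,
      (∀ o, S.orbital χ χ' o (S.conv (L1Class.prodFn W finf (ffin N)) (f₂ N)) ≠ 0 → d o ≤ T → o ∈ s) ∧
        (s.card : ℝ) ≤ C' * Real.exp (α * T))
    (hdecay : ∀ N o, o ≠ o₀ → ‖S.orbital χ χ' o (S.conv (L1Class.prodFn W finf (ffin N)) (f₂ N))‖ ≤
      C * Real.exp (-((β + δ) * d o)))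
    {N₂ : ℕ} (hsparse : ∀ N, N₂ < N → ∀ o, o ≠ o₀ →
      S.orbital χ χ' o (S.conv (L1Class.prodFn W finf (ffin N)) (f₂ N)) ≠ 0 → g N ≤ d o)
    (hmain : ∃ m : ℝ, 0 < m ∧ ∃ N₁ : ℕ, ∀ N ≥ N₁,
      m ≤ ‖S.orbital χ χ' o₀ (S.conv (L1Class.prodFn W finf (ffin N)) (f₂ N))‖) :
    L1Class.LevelFibreDominated W S χ χ' {o₀} finf ffin f₂ :=
  fibreDominatedFrom_singleton_of_support_count S hgeo hχ hχ' o₀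
    (fun N => S.conv (L1Class.prodFn W finf (ffin N)) (f₂ N)) hf hP d g hd hC hC' hαβ hβ hδ hg hcount hdecay
    hsparse hmain

end Arch

section Weighted

variable {G : Type} [Group G] [TopologicalSpace G] [MeasurableSpace G] (S : Setting G)

/-- **`TailDominatedFrom` in the LEVEL-MEASURE form** ((R-30), S15136/S15141): the level weight `v N > 0` on both
sides — `hdecay : ‖O_o(f N)‖ ≤ v N · C · e^{−(β+δ) d o}` off `o₀`, `hmain : m · v N ≤ ‖O_{o₀}(f N)‖` — cancels. -/
theorem tailDominatedFrom_of_support_count_weighted (χ : S.T → ℂ) (χ' : S.T' → ℂ) (o₀ : S.Orbit) (f : ℕ → G → ℂ)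
    (d : S.Orbit → ℝ) (g : ℕ → ℝ) (v : ℕ → ℝ) (hv : ∀ N, 0 < v N) (hd : ∀ o, 0 ≤ d o) {C C' α β δ : ℝ}
    (hC : 0 ≤ C) (hC' : 0 ≤ C') (hαβ : α < β) (hβ : 0 ≤ β) (hδ : 0 < δ) (hg : Tendsto g atTop atTop)
    (hcount : ∀ (N : ℕ) (T : ℝ), ∃ s : Finset S.Orbit,
      (∀ o, S.orbital χ χ' o (f N) ≠ 0 → d o ≤ T → o ∈ s) ∧ (s.card : ℝ) ≤ C' * Real.exp (α * T))
    (hdecay : ∀ N o, o ≠ o₀ → ‖S.orbital χ χ' o (f N)‖ ≤ v N * C * Real.exp (-((β + δ) * d o)))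
    (hsparse : ∀ N o, o ≠ o₀ → S.orbital χ χ' o (f N) ≠ 0 → g N ≤ d o)
    (hmain : ∃ m : ℝ, 0 < m ∧ ∃ N₁ : ℕ, ∀ N ≥ N₁, m * v N ≤ ‖S.orbital χ χ' o₀ (f N)‖) :
    L1Class.TailDominatedFrom S χ χ' o₀ f := by
  obtain ⟨N₀, hN₀⟩ := exists_tail_lt_of_support_count_weighted (fun N o => S.orbital χ χ' o (f N)) o₀ d g v hv
    hd hC hC' hαβ hβ hδ hg hcount hdecay hsparse hmain
  exact ⟨N₀, fun N hN => ⟨(hN₀ N hN).1, (hN₀ N hN).2.1, (hN₀ N hN).2.2⟩⟩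

/-- the fibre shape with `E = {o₀}` in the level-measure form. -/
theorem fibreDominatedFrom_singleton_of_support_count_weighted (hgeo : L1Class.RtfGeometricL1 S) {χ : S.T → ℂ}
    {χ' : S.T' → ℂ} (hχ : S.IsCharacter χ) (hχ' : S.IsCharacter' χ') (o₀ : S.Orbit) (f : ℕ → G → ℂ)
    (hf : ∀ N, IsTestL1 S (f N)) (hP : ∀ N, L1Class.PoincareSummable S (f N))
    (d : S.Orbit → ℝ) (g : ℕ → ℝ) (v : ℕ → ℝ) (hv : ∀ N, 0 < v N) (hd : ∀ o, 0 ≤ d o) {C C' α β δ : ℝ}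
    (hC : 0 ≤ C) (hC' : 0 ≤ C') (hαβ : α < β) (hβ : 0 ≤ β) (hδ : 0 < δ) (hg : Tendsto g atTop atTop)
    (hcount : ∀ (N : ℕ) (T : ℝ), ∃ s : Finset S.Orbit,
      (∀ o, S.orbital χ χ' o (f N) ≠ 0 → d o ≤ T → o ∈ s) ∧ (s.card : ℝ) ≤ C' * Real.exp (α * T))
    (hdecay : ∀ N o, o ≠ o₀ → ‖S.orbital χ χ' o (f N)‖ ≤ v N * C * Real.exp (-((β + δ) * d o)))
    (hsparse : ∀ N o, o ≠ o₀ → S.orbital χ χ' o (f N) ≠ 0 → g N ≤ d o)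
    (hmain : ∃ m : ℝ, 0 < m ∧ ∃ N₁ : ℕ, ∀ N ≥ N₁, m * v N ≤ ‖S.orbital χ χ' o₀ (f N)‖) :
    L1Class.FibreDominatedFrom S χ χ' {o₀} f := by
  obtain ⟨N₀, hN₀⟩ := tailDominatedFrom_of_support_count_weighted S χ χ' o₀ f d g v hv hd hC hC' hαβ hβ hδ hg
    hcount hdecay hsparse hmain
  exact ⟨N₀, fun N hN =>
    L1Class.fibreDominated_singleton_of_tailDominated hgeo hχ hχ' (hf N) (hP N) (hN₀ N hN)⟩

end Weighted

section ArchWeighted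

open NumberField

variable {k : Type} [Field k] [NumberField k] (W : PlaneData k) [MeasurableSpace (GA W)]

/-- **C-L4-TAIL in the v4 fibre shape, `E = {o₀}`, LEVEL-MEASURE FORM**: `LevelFibreDominated` for the level family
`N ↦ prodFn finf (ffin N) ⋆ f₂ N` from the displays with the level weight `v N` on both sides. -/
theorem levelFibreDominated_singleton_of_support_count_weighted (S : Setting (GA W))
    (hgeo : L1Class.RtfGeometricL1 S) {χ : S.T → ℂ} {χ' : S.T' → ℂ} (hχ : S.IsCharacter χ)
    (hχ' : S.IsCharacter' χ') (o₀ : S.Orbit) (finf : GA W → ℂ) (ffin f₂ : ℕ → GA W → ℂ)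
    (hf : ∀ N, IsTestL1 S (S.conv (L1Class.prodFn W finf (ffin N)) (f₂ N)))
    (hP : ∀ N, L1Class.PoincareSummable S (S.conv (L1Class.prodFn W finf (ffin N)) (f₂ N)))
    (d : S.Orbit → ℝ) (g : ℕ → ℝ) (v : ℕ → ℝ) (hv : ∀ N, 0 < v N) (hd : ∀ o, 0 ≤ d o) {C C' α β δ : ℝ}
    (hC : 0 ≤ C) (hC' : 0 ≤ C') (hαβ : α < β) (hβ : 0 ≤ β) (hδ : 0 < δ) (hg : Tendsto g atTop atTop)
    (hcount : ∀ (N : ℕ) (T : ℝ), ∃ s : Finset S.Orbit,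
      (∀ o, S.orbital χ χ' o (S.conv (L1Class.prodFn W finf (ffin N)) (f₂ N)) ≠ 0 → d o ≤ T → o ∈ s) ∧
        (s.card : ℝ) ≤ C' * Real.exp (α * T))
    (hdecay : ∀ N o, o ≠ o₀ → ‖S.orbital χ χ' o (S.conv (L1Class.prodFn W finf (ffin N)) (f₂ N))‖ ≤
      v N * C * Real.exp (-((β + δ) * d o)))
    (hsparse : ∀ N o, o ≠ o₀ → S.orbital χ χ' o (S.conv (L1Class.prodFn W finf (ffin N)) (f₂ N)) ≠ 0 →
      g N ≤ d o)
    (hmain : ∃ m : ℝ, 0 < m ∧ ∃ N₁ : ℕ, ∀ N ≥ N₁,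
      m * v N ≤ ‖S.orbital χ χ' o₀ (S.conv (L1Class.prodFn W finf (ffin N)) (f₂ N))‖) :
    L1Class.LevelFibreDominated W S χ χ' {o₀} finf ffin f₂ :=
  fibreDominatedFrom_singleton_of_support_count_weighted S hgeo hχ hχ' o₀
    (fun N => S.conv (L1Class.prodFn W finf (ffin N)) (f₂ N)) hf hP d g v hv hd hC hC' hαβ hβ hδ hg hcount
    hdecay hsparse hmain

end ArchWeighted

end Summit.Ventures.HodgeRepro.Tier4.Line4

end
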